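import Summits.KontsevichZagierPeriods.KontsevichZagierPeriods.Theorems.OctahedralSymmetryZhaoRelationInKZCommon
import Summits.KontsevichZagierPeriods.KontsevichZagierPeriods.Theorems.OctahedralSymmetryZhaoRelationInKZConj
import Summits.KontsevichZagierPeriods.KontsevichZagierPeriods.Theorems.OctahedralSymmetryZhaoRelationInKZSigma
import Summits.KontsevichZagierPeriods.KontsevichZagierPeriods.Theorems.OctahedralSymmetryZhaoRelationInKZDil2
import Summits.KontsevichZagierPeriods.KontsevichZagierPeriods.Theorems.OctahedralSymmetryZhaoRelationInKZShuffle
import Summits.KontsevichZagierPeriods.KontsevichZagierPeriods.Theorems.OctahedralSymmetryZhaoRelationInKZStuffle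

/-!
# `ZhaoRelationInKZ` (stmt-KontsevichZagierPeriods-9433, route `OctahedralSymmetry`) — line `Sketch`:
the engines in the line's vocabulary, the lifted-dilation rows and the finite-double-shuffle rows

The five analytic engines of the line are landed as separate helper files over the tree's
vocabulary (`stub_conj`, `stub_sigma`, `stub_dil2`, `stub_shuffle`, `stub_stuffle`, each with its
docstring there). This file (i) instantiates them with the line's class functions `Z false`,
`Z true` and product classes `ZP` (`sigma_rows`, `conj_rows`, `dil2_Z`, `shuffle_Z`, `stuffle_Z`),
and (ii) performs the purely algebraic glue in the free abelian group `KZ.FormalRep`: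

* `dilLift_rows`: the weight-2 distribution relation multiplied by the classes of a letter through
  the product ideal (`KZ.of_mul_mem_relations`), real and imaginary parts of the complex product
  recombined, every product dissected by the shuffle (`shuffle_sum_re/im`) — these are the rows
  `Row.re/Row.im (dilLiftTerms a U)` of the certificate;
* `fds_rows`: stuffle expansion minus shuffle expansion of `I(i^x)·I(i^y, i^{y+z})` — the rows
  `Row.re/Row.im (fdsTerms x y z)`.

References: J. Zhao, Doc. Math. 15 (2010), §2 (FDS), §5; M. Kontsevich, D. Zagier, *Periods*
(2001), §1.2, §4.1.
-/

noncomputable section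

open Set MeasureTheory
open Literature.NumberTheory.Transcendental Literature.NumberTheory.Transcendental.KZ

namespace Summit.KontsevichZagierPeriods.OctahedralSymmetry.ZhaoRelationInKZ

/-! ## The stubs in the line's vocabulary (`Z`, `ZP`) -/

/-- `Z false` agrees with the canonical real-part classes on convergent words. [folklore] -/
theorem Z_false_spec (W : List (Fin 5)) (h : LevelFour.IsConvergent W) :
    Z false W = of (levelFourRepRe W (integrableOn_levelFourIntegrandC h)) := Z_eq_of false W h

/-- `Z true` agrees with the canonical imaginary-part classes on convergent words. [folklore] -/
theorem Z_true_spec (W : List (Fin 5)) (h : LevelFour.IsConvergent W) :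
    Z true W = of (levelFourRepIm W (integrableOn_levelFourIntegrandC h)) := Z_eq_of true W h

/-- The product classes, unfolded to `levelFourRepRe/Im`. [folklore] -/
theorem ZP_spec (b b' : Bool) (U V : List (Fin 5)) (hU : LevelFour.IsConvergent U)
    (hV : LevelFour.IsConvergent V) :
    ZP b b' U V = of ((bif b then levelFourRepIm U (integrableOn_levelFourIntegrandC hU)
        else levelFourRepRe U (integrableOn_levelFourIntegrandC hU)).prod
      (bif b' then levelFourRepIm V (integrableOn_levelFourIntegrandC hV)
        else levelFourRepRe V (integrableOn_levelFourIntegrandC hV))) := by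
  rw [ZP_eq_of b b' U V hU hV]; cases b <;> cases b' <;> rfl

/-- σ-rows in the line's vocabulary (`stub_sigma` with `Zr = Z false`, `Zi = Z true`).
[cite: Zhao2008, §4] -/
theorem sigma_rows (m₀ m₁ m₂ : Fin 5) (h₀ : m₀ ≠ 0) (h₂ : m₂ ≠ 4) :
    evalRow (Row.re (sigmaTerms [m₀, m₁, m₂])) ∈ relations ∧
    evalRow (Row.im (sigmaTerms [m₀, m₁, m₂])) ∈ relations := by
  obtain ⟨hre, him⟩ := stub_sigma (Z false) (Z true) Z_false_spec Z_true_spec m₀ m₁ m₂ h₀ h₂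
  constructor
  · rw [evalRow_re]
    simpa [sigmaTerms, List.map_map, Function.comp_def] using hre
  · rw [evalRow_im]
    simpa [sigmaTerms, List.map_map, Function.comp_def] using him

/-- Conjugation rows in the line's vocabulary (`stub_conj` with `Z false`, `Z true`). [folklore] -/
theorem conj_rows (m₀ m₁ m₂ : Fin 5) :
    evalRow (Row.re (conjTermsRe [m₀, m₁, m₂])) ∈ relations ∧
    evalRow (Row.im (conjTermsIm [m₀, m₁, m₂])) ∈ relations ∧
    (LevelFour.conjWord [m₀, m₁, m₂] = [m₀, m₁, m₂] →
      evalRow (Row.im (imZeroTerms [m₀, m₁, m₂])) ∈ relations) := by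
  obtain ⟨hre, him, h0⟩ := stub_conj (Z false) (Z true) Z_false_spec (Z_eq_zero false)
    Z_true_spec (Z_eq_zero true) m₀ m₁ m₂
  refine ⟨?_, ?_, fun h => ?_⟩
  · rw [evalRow_re]
    simpa [conjTermsRe, sub_eq_add_neg] using hre
  · rw [evalRow_im]
    simpa [conjTermsIm] using him
  · rw [evalRow_im]
    simpa [imZeroTerms] using h0 h

/-- Weight-2 dilation in the line's vocabulary (`stub_dil2` with `Z false`, `Z true`).
[cite: Zhao2010, §5] -/
theorem dil2_Z (u₀ u₁ : Fin 5) (hu₀ : u₀ = 2 ∨ u₀ = 4) (hu₁ : u₁ = 0 ∨ u₁ = 2) :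
    Z false [u₀, u₁] -
        ((LevelFour.expand LevelFour.dilLetter [u₀, u₁]).map fun cV => cV.1 • Z false cV.2).sum
      ∈ relations ∧
    Z true [u₀, u₁] -
        ((LevelFour.expand LevelFour.dilLetter [u₀, u₁]).map fun cV => cV.1 • Z true cV.2).sum
      ∈ relations ∧
    Z true [u₀, u₁] ∈ relations :=
  stub_dil2 (Z false) (Z true) Z_false_spec Z_true_spec u₀ u₁ hu₀ hu₁

/-- Shuffle (1)×(2) in the line's vocabulary (`stub_shuffle` over `ZP`, `Z`).
[cite: Zhao2010, §2 Lemma 2.2] -/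
theorem shuffle_Z (a v₀ v₁ : Fin 5) (ha₀ : a ≠ 0) (ha₄ : a ≠ 4) (hv₀ : v₀ ≠ 0) (hv₁ : v₁ ≠ 4) :
    ZP false false [a] [v₀, v₁] - ZP true true [a] [v₀, v₁]
        - (Z false [a, v₀, v₁] + Z false [v₀, a, v₁] + Z false [v₀, v₁, a]) ∈ relations ∧
    ZP false true [a] [v₀, v₁] + ZP true false [a] [v₀, v₁]
        - (Z true [a, v₀, v₁] + Z true [v₀, a, v₁] + Z true [v₀, v₁, a]) ∈ relations := by
  have ha : LevelFour.IsConvergent [a] := ⟨by simpa using ha₀, by simpa using ha₄⟩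
  have hv : LevelFour.IsConvergent [v₀, v₁] := ⟨by simpa using hv₀, by simpa using hv₁⟩
  have h₁ : LevelFour.IsConvergent [a, v₀, v₁] := ⟨by simpa using ha₀, by simpa using hv₁⟩
  have h₂ : LevelFour.IsConvergent [v₀, a, v₁] := ⟨by simpa using hv₀, by simpa using hv₁⟩
  have h₃ : LevelFour.IsConvergent [v₀, v₁, a] := ⟨by simpa using hv₀, by simpa using ha₄⟩
  obtain ⟨hre, him⟩ := stub_shuffle a v₀ v₁ ha hv h₁ h₂ h₃
  rw [ZP_spec _ _ _ _ ha hv, ZP_spec _ _ _ _ ha hv, Z_false_spec _ h₁, Z_false_spec _ h₂,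
    Z_false_spec _ h₃, ZP_spec _ _ _ _ ha hv, ZP_spec _ _ _ _ ha hv, Z_true_spec _ h₁,
    Z_true_spec _ h₂, Z_true_spec _ h₃]
  exact ⟨hre, him⟩

/-- The stuffle (1)×(1,1) in the line's vocabulary (`stub_stuffle` over `ZP`, `Z`).
[cite: Zhao2010, §2 Def. 2.4] -/
theorem stuffle_Z (x y z : Fin 4) (hx : x ≠ 0) (hy : y ≠ 0) :
    ZP false false [Fin.castSucc x] [Fin.castSucc y, Fin.castSucc (y + z)]
      - ZP true true [Fin.castSucc x] [Fin.castSucc y, Fin.castSucc (y + z)]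
      - (Z false [Fin.castSucc x, Fin.castSucc (x + y), Fin.castSucc (x + y + z)]
        + Z false [Fin.castSucc y, Fin.castSucc (x + y), Fin.castSucc (x + y + z)]
        + Z false [Fin.castSucc y, Fin.castSucc (y + z), Fin.castSucc (x + y + z)]
        - Z false [4, Fin.castSucc (x + y), Fin.castSucc (x + y + z)]
        - Z false [Fin.castSucc y, 4, Fin.castSucc (x + y + z)]) ∈ relations ∧
    ZP false true [Fin.castSucc x] [Fin.castSucc y, Fin.castSucc (y + z)]
      + ZP true false [Fin.castSucc x] [Fin.castSucc y, Fin.castSucc (y + z)]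
      - (Z true [Fin.castSucc x, Fin.castSucc (x + y), Fin.castSucc (x + y + z)]
        + Z true [Fin.castSucc y, Fin.castSucc (x + y), Fin.castSucc (x + y + z)]
        + Z true [Fin.castSucc y, Fin.castSucc (y + z), Fin.castSucc (x + y + z)]
        - Z true [4, Fin.castSucc (x + y), Fin.castSucc (x + y + z)]
        - Z true [Fin.castSucc y, 4, Fin.castSucc (x + y + z)]) ∈ relations := by
  have hc4 : ∀ m : Fin 4, Fin.castSucc m ≠ (4 : Fin 5) := fun m h => by
    have := congrArg Fin.val h; simp at this; omega
  have hcx : Fin.castSucc x ≠ 0 := fun h => hx (Fin.castSucc_injective _ (by simpa using h))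
  have hcy : Fin.castSucc y ≠ 0 := fun h => hy (Fin.castSucc_injective _ (by simpa using h))
  have ha : LevelFour.IsConvergent [Fin.castSucc x] := ⟨by simpa using hcx, by simpa using hc4 x⟩
  have hv : LevelFour.IsConvergent [Fin.castSucc y, Fin.castSucc (y + z)] :=
    ⟨by simpa using hcy, by simpa using hc4 _⟩
  obtain ⟨hre, him⟩ := stub_stuffle (Z false) (Z true) Z_false_spec Z_true_spec x y z hx hy ha hv
  rw [ZP_spec _ _ _ _ ha hv, ZP_spec _ _ _ _ ha hv, ZP_spec _ _ _ _ ha hv, ZP_spec _ _ _ _ ha hv]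
  exact ⟨hre, him⟩

/-! ## Glue: lifted dilation rows and finite-double-shuffle rows -/

/-- The real part of a complex product of classes, expanded: for a letter `a` and a term list
over two-letter words, `Σ c (R_a×R_V − J_a×J_V)` is congruent to `Σ c Σ_{W ∈ a ш V} [Re W]`
(shuffle dissection termwise). [cite: Zhao2010, §2 Lemma 2.2] -/
theorem shuffle_sum_re (a : Fin 5) (ha₀ : a ≠ 0) (ha₄ : a ≠ 4)
    (L : List (ℤ × List (Fin 5)))
    (hL : ∀ cV ∈ L, ∃ v₀ v₁ : Fin 5, cV.2 = [v₀, v₁] ∧ v₀ ≠ 0 ∧ v₁ ≠ 4) :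
    (L.map fun cV => cV.1 • (ZP false false [a] cV.2 - ZP true true [a] cV.2)).sum -
      (L.map fun cV => ((shuffle12 a cV.2).map fun W => cV.1 • Z false W).sum).sum ∈ relations := by
  induction L with
  | nil => simp [relations.zero_mem]
  | cons cV L ih =>
    obtain ⟨v₀, v₁, hV, hv₀, hv₁⟩ := hL cV (by simp)
    have h1 := (shuffle_Z a v₀ v₁ ha₀ ha₄ hv₀ hv₁).1
    have ih' := ih fun cV' h' => hL cV' (by simp [h'])
    rw [List.map_cons, List.sum_cons, List.map_cons, List.sum_cons, hV,
      show shuffle12 a [v₀, v₁] = [[a, v₀, v₁], [v₀, a, v₁], [v₀, v₁, a]] from rfl]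
    simp only [List.map_cons, List.map_nil, List.sum_cons, List.sum_nil, add_zero]
    convert relations.add_mem (relations.zsmul_mem h1 cV.1) ih' using 1
    simp only [smul_sub, smul_add]
    abel

/-- The imaginary part of a complex product of classes, expanded (shuffle dissection termwise).
[cite: Zhao2010, §2 Lemma 2.2] -/
theorem shuffle_sum_im (a : Fin 5) (ha₀ : a ≠ 0) (ha₄ : a ≠ 4)
    (L : List (ℤ × List (Fin 5)))
    (hL : ∀ cV ∈ L, ∃ v₀ v₁ : Fin 5, cV.2 = [v₀, v₁] ∧ v₀ ≠ 0 ∧ v₁ ≠ 4) :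
    (L.map fun cV => cV.1 • (ZP false true [a] cV.2 + ZP true false [a] cV.2)).sum -
      (L.map fun cV => ((shuffle12 a cV.2).map fun W => cV.1 • Z true W).sum).sum ∈ relations := by
  induction L with
  | nil => simp [relations.zero_mem]
  | cons cV L ih =>
    obtain ⟨v₀, v₁, hV, hv₀, hv₁⟩ := hL cV (by simp)
    have h1 := (shuffle_Z a v₀ v₁ ha₀ ha₄ hv₀ hv₁).2
    have ih' := ih fun cV' h' => hL cV' (by simp [h'])
    rw [List.map_cons, List.sum_cons, List.map_cons, List.sum_cons, hV,
      show shuffle12 a [v₀, v₁] = [[a, v₀, v₁], [v₀, a, v₁], [v₀, v₁, a]] from rfl]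
    simp only [List.map_cons, List.map_nil, List.sum_cons, List.sum_nil, add_zero]
    convert relations.add_mem (relations.zsmul_mem h1 cV.1) ih' using 1
    simp only [smul_sub, smul_add]
    abel

end Summit.KontsevichZagierPeriods.OctahedralSymmetry.ZhaoRelationInKZ

namespace Summit.KontsevichZagierPeriods.OctahedralSymmetry.ZhaoRelationInKZ

/-! ## Small list lemmas -/

/-- Pulling a negation out of a list sum. [folklore] -/
theorem list_sum_map_neg {α M : Type*} [AddCommGroup M] (l : List α) (f : α → M) :
    (l.map fun a => -f a).sum = -(l.map f).sum := by
  induction l with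
  | nil => simp
  | cons a l ih => simp [ih]; abel

/-- A list sum of differences. [folklore] -/
theorem list_sum_map_sub {α M : Type*} [AddCommGroup M] (l : List α) (f g : α → M) :
    (l.map fun a => f a - g a).sum = (l.map f).sum - (l.map g).sum := by
  induction l with
  | nil => simp
  | cons a l ih => simp [ih]; abel

/-- A list sum of sums. [folklore] -/
theorem list_sum_map_add {α M : Type*} [AddCommMonoid M] (l : List α) (f g : α → M) :
    (l.map fun a => f a + g a).sum = (l.map f).sum + (l.map g).sum := by
  induction l with
  | nil => simp
  | cons a l ih => simp [ih]; abel

/-- Left multiplication distributes over a list sum of scalar multiples in a ring. [folklore] -/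
theorem mul_list_sum_map_zsmul {α : Type*} (l : List α) (x : FormalRep) (c : α → ℤ)
    (f : α → FormalRep) : x * (l.map fun a => c a • f a).sum = (l.map fun a => c a • (x * f a)).sum := by
  induction l with
  | nil => simp
  | cons a l ih => simp [mul_add, ih, mul_smul_comm]

/-- The second half of `dilLiftTerms`, evaluated: the `flatMap` of the negated expansion reads as an
iterated sum. [folklore] -/
theorem sum_dilLift_tail (b : Bool) (a : Fin 5) (E : List (ℤ × List (Fin 5))) :
    ((E.flatMap fun cV => (shuffle12 a cV.2).map fun W => (-cV.1, W)).map
        fun p : ℤ × List (Fin 5) => p.1 • Z b p.2).sum =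
      ((E.map fun cV => (-cV.1, cV.2)).map
        fun cV => ((shuffle12 a cV.2).map fun W => cV.1 • Z b W).sum).sum := by
  induction E with
  | nil => simp
  | cons cV E ih =>
    rw [List.flatMap_cons, List.map_append, List.sum_append, ih, List.map_cons, List.map_cons,
      List.sum_cons, List.map_map]
    rfl

/-! ## Glue: the lifted dilation rows -/

/-- The letters produced by `expand dil` on a level-2 weight-2 word are two-letter words with a
convergent shape (first letter `∈ {i, −i, 0}`, last letter a pole `≠ 0`). [folklore] -/
theorem expand_dil_shape (u₀ u₁ : Fin 5) (hu₀ : u₀ = 2 ∨ u₀ = 4) (hu₁ : u₁ = 0 ∨ u₁ = 2) :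
    ∀ cV ∈ LevelFour.expand LevelFour.dilLetter [u₀, u₁],
      ∃ v₀ v₁ : Fin 5, cV.2 = [v₀, v₁] ∧ v₀ ≠ 0 ∧ v₁ ≠ 4 := by
  rcases hu₀ with rfl | rfl <;> rcases hu₁ with rfl | rfl <;> decide

/-- **Lifted dilation rows** (family dil of the certificate): for `a ∈ {i, −1, −i}` (letters
`1, 2, 3`) and a level-2 weight-2 word `U`, the rows `Row.re/Row.im (dilLiftTerms a U)` are KZ
relations — the weight-2 relation of `stub_dil2` multiplied by the classes of the letter `a`
(product ideal `KZ.of_mul_mem_relations`), real and imaginary parts of the complex product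
recombined, and every product dissected by `stub_shuffle`. [cite: Zhao2010, §5] -/
theorem dilLift_rows (a u₀ u₁ : Fin 5) (ha₀ : a ≠ 0) (ha₄ : a ≠ 4) (hu₀ : u₀ = 2 ∨ u₀ = 4)
    (hu₁ : u₁ = 0 ∨ u₁ = 2) :
    evalRow (Row.re (dilLiftTerms a [u₀, u₁])) ∈ relations ∧
    evalRow (Row.im (dilLiftTerms a [u₀, u₁])) ∈ relations := by
  obtain ⟨hre, him, him0⟩ := dil2_Z u₀ u₁ hu₀ hu₁
  have ha : LevelFour.IsConvergent [a] := by
    constructor <;> simpa using by assumption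
  set E := LevelFour.expand LevelFour.dilLetter [u₀, u₁] with hE
  -- the term list `(1, U) :: (−c, V)…` over which the shuffle is applied
  set L : List (ℤ × List (Fin 5)) := (1, [u₀, u₁]) :: E.map fun cV => (-cV.1, cV.2) with hL_def
  have hLshape : ∀ cV ∈ L, ∃ v₀ v₁ : Fin 5, cV.2 = [v₀, v₁] ∧ v₀ ≠ 0 ∧ v₁ ≠ 4 := by
    intro cV hcV
    simp only [hL_def, List.mem_cons, List.mem_map] at hcV
    rcases hcV with rfl | ⟨cV', h', rfl⟩
    · refine ⟨u₀, u₁, rfl, ?_, ?_⟩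
      · rcases hu₀ with rfl | rfl <;> decide
      · rcases hu₁ with rfl | rfl <;> decide
    · exact expand_dil_shape u₀ u₁ hu₀ hu₁ cV' h'
  -- the rows, unfolded
  have hrow : ∀ b : Bool,
      evalRow ((if b then Row.im else Row.re) (dilLiftTerms a [u₀, u₁])) =
        (L.map fun cV => ((shuffle12 a cV.2).map fun W => cV.1 • Z b W).sum).sum := by
    intro b
    have h1 : evalRow ((if b then Row.im else Row.re) (dilLiftTerms a [u₀, u₁])) =
        ((dilLiftTerms a [u₀, u₁]).map fun p => p.1 • Z b p.2).sum := by
      cases b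
      · exact evalRow_re _
      · exact evalRow_im _
    rw [h1, dilLiftTerms, ← hE, List.map_append, List.sum_append, hL_def, List.map_cons,
      List.sum_cons, List.map_map, sum_dilLift_tail]
    congr 1
  -- the ideal step, real part: `Z_f[a]·ρ_re − Z_t[a]·ρ_im`
  have hIre : Z false [a] * (Z false [u₀, u₁] - (E.map fun cV => cV.1 • Z false cV.2).sum) -
      Z true [a] * (Z true [u₀, u₁] - (E.map fun cV => cV.1 • Z true cV.2).sum) ∈ relations := by
    refine relations.sub_mem ?_ ?_
    · rw [Z_eq_of false [a] ha]; exact of_mul_mem_relations _ hre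
    · rw [Z_eq_of true [a] ha]; exact of_mul_mem_relations _ him
  have hIim : Z false [a] * (Z true [u₀, u₁] - (E.map fun cV => cV.1 • Z true cV.2).sum) +
      Z true [a] * (Z false [u₀, u₁] - (E.map fun cV => cV.1 • Z false cV.2).sum) ∈ relations := by
    refine relations.add_mem ?_ ?_
    · rw [Z_eq_of false [a] ha]; exact of_mul_mem_relations _ him
    · rw [Z_eq_of true [a] ha]; exact of_mul_mem_relations _ hre
  -- rewrite the ideal elements as the `L`-sums of `ZP`'s
  have eRe : Z false [a] * (Z false [u₀, u₁] - (E.map fun cV => cV.1 • Z false cV.2).sum) -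
      Z true [a] * (Z true [u₀, u₁] - (E.map fun cV => cV.1 • Z true cV.2).sum) =
      (L.map fun cV => cV.1 • (ZP false false [a] cV.2 - ZP true true [a] cV.2)).sum := by
    simp only [hL_def, List.map_cons, List.sum_cons, List.map_map, Function.comp_def, one_smul,
      mul_sub, mul_list_sum_map_zsmul, ZP_eq_mul, neg_smul, smul_sub, list_sum_map_sub,
      list_sum_map_neg]
    abel
  have eIm : Z false [a] * (Z true [u₀, u₁] - (E.map fun cV => cV.1 • Z true cV.2).sum) +
      Z true [a] * (Z false [u₀, u₁] - (E.map fun cV => cV.1 • Z false cV.2).sum) =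
      (L.map fun cV => cV.1 • (ZP false true [a] cV.2 + ZP true false [a] cV.2)).sum := by
    simp only [hL_def, List.map_cons, List.sum_cons, List.map_map, Function.comp_def, one_smul,
      mul_sub, mul_list_sum_map_zsmul, ZP_eq_mul, neg_smul, smul_add, list_sum_map_add,
      list_sum_map_neg]
    abel
  constructor
  · have h := relations.sub_mem (eRe ▸ hIre) (shuffle_sum_re a ha₀ ha₄ L hLshape)
    rw [sub_sub_cancel] at h
    have e := hrow false
    simp only [Bool.false_eq_true, if_false] at e
    rwa [e]
  · have h := relations.sub_mem (eIm ▸ hIim) (shuffle_sum_im a ha₀ ha₄ L hLshape)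
    rw [sub_sub_cancel] at h
    have e := hrow true
    simp only [if_true] at e
    rwa [e]

/-! ## Glue: the finite double shuffle rows -/

/-- **Finite double shuffle rows, block (1)×(1,1)** (family fds of the certificate): for
`x ≠ 0`, `y ≠ 0` the rows `Row.re/Row.im (fdsTerms x y z)` — stuffle expansion minus shuffle
expansion of `I(i^x)·I(i^y, i^{y+z})` — are KZ relations (`stub_stuffle` minus `stub_shuffle`).
[cite: Zhao2010, §2 (FDS)] -/
theorem fds_rows (x y z : Fin 4) (hx : x ≠ 0) (hy : y ≠ 0) :
    evalRow (Row.re (fdsTerms x y z)) ∈ relations ∧ evalRow (Row.im (fdsTerms x y z)) ∈ relations := by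
  obtain ⟨hstR, hstI⟩ := stuffle_Z x y z hx hy
  have hcx : Fin.castSucc x ≠ 0 := fun h => hx (Fin.castSucc_injective _ (by simpa using h))
  have hcy : Fin.castSucc y ≠ 0 := fun h => hy (Fin.castSucc_injective _ (by simpa using h))
  have hc4 : ∀ m : Fin 4, Fin.castSucc m ≠ (4 : Fin 5) := fun m h => by
    have := congrArg Fin.val h; simp at this; omega
  obtain ⟨hshR, hshI⟩ := shuffle_Z (Fin.castSucc x) (Fin.castSucc y) (Fin.castSucc (y + z))
    hcx (hc4 x) hcy (hc4 _)
  constructor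
  · have h := relations.sub_mem hshR hstR
    rw [evalRow_re]
    simp only [fdsTerms, List.map_cons, List.map_nil, List.sum_cons, List.sum_nil, one_smul,
      neg_smul, add_zero]
    convert h using 1
    abel
  · have h := relations.sub_mem hshI hstI
    rw [evalRow_im]
    simp only [fdsTerms, List.map_cons, List.map_nil, List.sum_cons, List.sum_nil, one_smul,
      neg_smul, add_zero]
    convert h using 1
    abel

end Summit.KontsevichZagierPeriods.OctahedralSymmetry.ZhaoRelationInKZ

end
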